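import Mathlib
import Literature.Computability.AlgebraicComplexity.DivisionSLP
import HarnessLib

/-!
# `SlsExponentFloor` (route `LinearSolveSplit`, stmt-MatrixMultiplication-28411) — file 1/2: the generic system

§1 two structural facts about computation sequences (`finset_restrict`: a sequence of length `s` reads at most `2s`
available elements; `fixed_of_divSeq`: a ring endomorphism fixing the constants and everything read fixes everything
computed); §2 the generic system `[X | b]` of size `n` over `ℂ(X, b)`, nonvanishing of generic determinants (column
selections, Cramer numerators), and the shift endomorphisms `x_v ↦ x_v + c` lifted to the fraction field.

Landing note: the lens-3 kernel `SlsExponentFloor.lean` (decomp-mm gen 5; sha256 96f85062…9cab, 421 lines, rc 0 ·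
0 sorry · audit ok:true, critic-endorsed 2026-08-30T05:29:09Z) is landed as two files for the gate rule «Theorems files
with proofs ≤ 400 lines» — `LinearSolveSplitSlsExponentFloorGeneric` (§1 two structural facts about computation
sequences, §2 the generic system `[X | b]`, generic determinants, the shift endomorphisms `x_v ↦ x_v + c`; imports no
route file) and `LinearSolveSplitSlsExponentFloor` (§3 the floor `n² ≤ 2s`, §4 the closer `slsExponentFloor_holds`);
statements and proofs unchanged (18 helper docstrings added), one namespace throughout.
Overview and references: module docstring of `Theorems/LinearSolveSplitSlsExponentFloor.lean` (file 2/2).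
-/

set_option linter.dupNamespace false -- `MatrixMultiplication.MatrixMultiplication` (summit = problem, D-0017)

noncomputable section

open scoped BigOperators Matrix
open Literature.Computability.AlgebraicComplexity (Derivable DivStep DivSeq)

namespace Summit.MatrixMultiplication.MatrixMultiplication.Theorems.LinearSolveSplitSlsExponentFloor


/-! ## 1. Two structural facts about computation sequences -/

section DivSeqFacts

variable {k : Type*} {K : Type*} [CommSemiring k] [Field K] [Algebra k K]

/-- **A computation sequence of length `s` reads at most `2s` inputs**: it is already a computation
sequence over some finite subset of the available set of size `≤ 2·length`. -/
theorem finset_restrict {l : List K} :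
    ∀ {A : Set K}, DivSeq k A l →
      ∃ R : Finset K, (↑R : Set K) ⊆ A ∧ R.card ≤ 2 * l.length ∧ DivSeq k (↑R : Set K) l := by
  classical
  induction l with
  | nil => intro A _; exact ⟨∅, by simp, by simp, trivial⟩
  | cons v l ih =>
    intro A h
    obtain ⟨x, hx, y, hy, hv⟩ := h.1
    obtain ⟨R', hR'A, hcard, hR'⟩ := ih h.2
    refine ⟨(R'.erase v ∪ {x, y}).filter (fun r => r ∈ A), ?_, ?_, ?_⟩
    · intro r hr
      exact (Finset.mem_filter.mp (Finset.mem_coe.mp hr)).2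
    · calc ((R'.erase v ∪ {x, y}).filter (fun r => r ∈ A)).card
          ≤ (R'.erase v ∪ {x, y}).card := Finset.card_filter_le _ _
        _ ≤ (R'.erase v).card + ({x, y} : Finset K).card := Finset.card_union_le _ _
        _ ≤ R'.card + 2 := add_le_add Finset.card_erase_le Finset.card_le_two
        _ ≤ 2 * (v :: l).length := by rw [List.length_cons]; omega
    · refine ⟨⟨x, ?_, y, ?_, hv⟩, hR'.mono ?_⟩
      · rcases hx with hx | hx
        · refine Or.inl (Finset.mem_coe.mpr (Finset.mem_filter.mpr ⟨?_, hx⟩))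
          simp
        · exact Or.inr hx
      · rcases hy with hy | hy
        · refine Or.inl (Finset.mem_coe.mpr (Finset.mem_filter.mpr ⟨?_, hy⟩))
          simp
        · exact Or.inr hy
      · intro r hr
        rcases eq_or_ne r v with rfl | hne
        · exact Set.mem_insert _ _
        · refine Set.mem_insert_of_mem _ (Finset.mem_coe.mpr (Finset.mem_filter.mpr ⟨?_, ?_⟩))
          · exact Finset.mem_union_left _ (Finset.mem_erase.mpr ⟨hne, Finset.mem_coe.mp hr⟩)
          · rcases (Set.mem_insert_iff.mp (hR'A hr)) with h' | h'
            · exact absurd h' hne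
            · exact h'

/-- **Computed elements are fixed by every ring endomorphism fixing the inputs and the constants.** -/
theorem fixed_of_divSeq {F : Type*} [FunLike F K K] [RingHomClass F K K] (σ : F)
    (hc : ∀ c : k, σ (algebraMap k K c) = algebraMap k K c) {l : List K} :
    ∀ {A : Set K}, (∀ a ∈ A, σ a = a) → DivSeq k A l → ∀ w ∈ l, σ w = w := by
  induction l with
  | nil => intro A _ _ w hw; simp at hw
  | cons v l ih =>
    intro A hA h w hw
    have hfix : ∀ z ∈ A ∪ Set.range (algebraMap k K), σ z = z := by
      rintro z (hz | ⟨c, rfl⟩)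
      · exact hA z hz
      · exact hc c
    have hv : σ v = v := by
      obtain ⟨x, hx, y, hy, hv⟩ := h.1
      rcases hv with ⟨c, d, rfl⟩ | rfl | ⟨-, rfl⟩
      · rw [map_add, Algebra.smul_def, Algebra.smul_def, map_mul, map_mul, hc, hc, hfix x hx,
          hfix y hy]
      · rw [map_mul, hfix x hx, hfix y hy]
      · rw [map_inv₀, hfix x hx]
    rcases List.mem_cons.mp hw with rfl | hw
    · exact hv
    · refine ih ?_ h.2 w hw
      intro a ha
      rcases Set.mem_insert_iff.mp ha with rfl | ha
      · exact hv
      · exact hA a ha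

end DivSeqFacts

/-! ## 2. The generic system `[X | b]` of size `n` -/

/-- The index set of the entries of `[X | b]`. -/
abbrev Idx (n : ℕ) : Type := Fin n × Fin (n + 1)

/-- `ℂ(X, b)`. -/
abbrev GF (n : ℕ) : Type := FractionRing (MvPolynomial (Idx n) ℂ)

/-- The entry `x_p` of `[X | b]` in `ℂ(X, b)`. -/
def gE (n : ℕ) (p : Idx n) : GF n :=
  algebraMap (MvPolynomial (Idx n) ℂ) (GF n) (MvPolynomial.X p)

/-- Distinct indices give distinct variables `x_p`. -/
theorem gE_injective (n : ℕ) : Function.Injective (gE n) := fun _ _ h =>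
  MvPolynomial.X_injective (IsFractionRing.injective (MvPolynomial (Idx n) ℂ) (GF n) h)

/-- The square matrix on the columns `c 0, …, c (n-1)` of `[X | b]`. -/
def colSel (n : ℕ) (c : Fin n → Fin (n + 1)) : Matrix (Fin n) (Fin n) (GF n) :=
  Matrix.of fun i j => gE n (i, c j)

/-- `X`. -/
def sysMatrix (n : ℕ) : Matrix (Fin n) (Fin n) (GF n) :=
  Matrix.of fun i j => gE n (i, Fin.castSucc j)

/-- `b`. -/
def sysRhs (n : ℕ) : Fin n → GF n := fun i => gE n (i, Fin.last n)

/-- `u = X⁻¹ b`. -/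
def sysSolution (n : ℕ) : Fin n → GF n := Matrix.mulVec (sysMatrix n)⁻¹ (sysRhs n)

/-- Entries of the generic matrix `X`: `X i j = x_{(i, j)}`. -/
theorem sysMatrix_apply (n : ℕ) (i j : Fin n) : sysMatrix n i j = gE n (i, Fin.castSucc j) := rfl

/-- Entries of the generic right-hand side `b`: `b i = x_{(i, n)}`. -/
theorem sysRhs_apply (n : ℕ) (i : Fin n) : sysRhs n i = gE n (i, Fin.last n) := rfl

/-- `X` is the column selection `castSucc` of the variables. -/
theorem sysMatrix_eq_colSel (n : ℕ) : sysMatrix n = colSel n Fin.castSucc := rfl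

/-! ### Generic determinants are nonzero -/

/-- The column renaming `ℂ[Z_{n×n}] →ₐ ℂ(X, b)`, `z_{ij} ↦ x_{i, c j}`. -/
def colHom (n : ℕ) (c : Fin n → Fin (n + 1)) : MvPolynomial (Fin n × Fin n) ℂ →ₐ[ℂ] GF n :=
  (IsScalarTower.toAlgHom ℂ (MvPolynomial (Idx n) ℂ) (GF n)).comp
    (MvPolynomial.rename fun p : Fin n × Fin n => (p.1, c p.2))

/-- The column-selection renaming `ℂ[Z_{n×n}] →ₐ ℂ(X, b)` is injective for injective `c`. -/
theorem colHom_injective {n : ℕ} {c : Fin n → Fin (n + 1)} (hc : Function.Injective c) :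
    Function.Injective (colHom n c) := by
  have hinj : Function.Injective fun p : Fin n × Fin n => ((p.1, c p.2) : Idx n) := by
    intro p q h
    simp only [Prod.mk.injEq] at h
    exact Prod.ext h.1 (hc h.2)
  exact (IsFractionRing.injective (MvPolynomial (Idx n) ℂ) (GF n)).comp
    (MvPolynomial.rename_injective _ hinj)

/-- `colHom` sends `Z_p` to the selected variable `x_{(p.1, c p.2)}`. -/
theorem colHom_X {n : ℕ} (c : Fin n → Fin (n + 1)) (p : Fin n × Fin n) :
    colHom n c (MvPolynomial.X p) = gE n (p.1, c p.2) := by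
  simp only [colHom, AlgHom.comp_apply, MvPolynomial.rename_X, IsScalarTower.toAlgHom_apply]
  rfl

/-- A column selection is the image of the generic matrix under `colHom`. -/
theorem colSel_eq_map {n : ℕ} (c : Fin n → Fin (n + 1)) :
    colSel n c = (Matrix.mvPolynomialX (Fin n) (Fin n) ℂ).map (colHom n c) := by
  ext i j
  rw [Matrix.map_apply, Matrix.mvPolynomialX_apply, colHom_X]
  rfl

/-- Column selections along injective `c` have nonzero determinant. -/
theorem det_colSel_ne_zero {n : ℕ} {c : Fin n → Fin (n + 1)} (hc : Function.Injective c) :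
    (colSel n c).det ≠ 0 := by
  rw [colSel_eq_map c]
  have h := RingHom.map_det (colHom n c : MvPolynomial (Fin n × Fin n) ℂ →+* GF n)
    (Matrix.mvPolynomialX (Fin n) (Fin n) ℂ)
  rw [RingHom.mapMatrix_apply] at h
  simp only [RingHom.coe_coe] at h
  rw [← h]
  exact (map_ne_zero_iff _ (colHom_injective hc)).mpr (Matrix.det_mvPolynomialX_ne_zero (Fin n) ℂ)

/-- The generic matrix `X` has nonzero determinant. -/
theorem det_sysMatrix_ne_zero (n : ℕ) : (sysMatrix n).det ≠ 0 := by
  rw [sysMatrix_eq_colSel]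
  exact det_colSel_ne_zero (Fin.castSucc_injective n)

/-- `X u = b`. -/
theorem sysMatrix_mulVec_sysSolution (n : ℕ) : sysMatrix n *ᵥ sysSolution n = sysRhs n := by
  rw [sysSolution, Matrix.mulVec_mulVec,
    Matrix.mul_nonsing_inv _ (isUnit_iff_ne_zero.mpr (det_sysMatrix_ne_zero n)), Matrix.one_mulVec]

/-- Replacing column `q` of `X` by `b` is again a column selection of `[X | b]`. -/
theorem update_castSucc_injective {n : ℕ} (q : Fin n) :
    Function.Injective (Function.update Fin.castSucc q (Fin.last n)) := by
  intro a b h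
  simp only [Function.update_apply] at h
  split_ifs at h with ha hb hb
  · exact ha.trans hb.symm
  · exact absurd h.symm (Fin.castSucc_lt_last b).ne
  · exact absurd h (Fin.castSucc_lt_last a).ne
  · exact Fin.castSucc_injective _ h

/-- Replacing column `q` of `X` by `b` is again a column selection. -/
theorem updateCol_eq_colSel {n : ℕ} (q : Fin n) :
    (sysMatrix n).updateCol q (sysRhs n) = colSel n (Function.update Fin.castSucc q (Fin.last n)) := by
  ext i j
  rw [Matrix.updateCol_apply, colSel, Matrix.of_apply, Function.update_apply, sysMatrix_apply,
    sysRhs_apply]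
  split_ifs <;> rfl

/-- Cramer: `det X • u = adj X · b`, so `det X · u_q = det X[b → col q]`. -/
theorem det_mul_sysSolution {n : ℕ} (q : Fin n) :
    (sysMatrix n).det * sysSolution n q = ((sysMatrix n).updateCol q (sysRhs n)).det := by
  have hcr : Matrix.cramer (sysMatrix n) (sysRhs n) = (sysMatrix n).det • sysSolution n := by
    calc Matrix.cramer (sysMatrix n) (sysRhs n)
        = (sysMatrix n).adjugate *ᵥ sysRhs n := Matrix.cramer_eq_adjugate_mulVec _ _
      _ = (sysMatrix n).adjugate *ᵥ (sysMatrix n *ᵥ sysSolution n) := by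
          rw [sysMatrix_mulVec_sysSolution]
      _ = ((sysMatrix n).adjugate * sysMatrix n) *ᵥ sysSolution n := Matrix.mulVec_mulVec _ _ _
      _ = (sysMatrix n).det • sysSolution n := by
          rw [Matrix.adjugate_mul, Matrix.smul_mulVec, Matrix.one_mulVec]
  have hq := congrFun hcr q
  rw [Matrix.cramer_apply, Pi.smul_apply, smul_eq_mul] at hq
  exact hq.symm

/-! ### The shift endomorphisms `x_v ↦ x_v + c` -/

/-- The substitution `x_v ↦ x_v + c`, `x_w ↦ x_w` (`w ≠ v`). -/
def shiftFun (n : ℕ) (v : Idx n) (c : ℂ) : Idx n → MvPolynomial (Idx n) ℂ :=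
  fun w => if w = v then MvPolynomial.X v + MvPolynomial.C c else MvPolynomial.X w

/-- … as a `ℂ`-algebra endomorphism of `ℂ[X, b]`. -/
def shiftAlg (n : ℕ) (v : Idx n) (c : ℂ) : MvPolynomial (Idx n) ℂ →ₐ[ℂ] MvPolynomial (Idx n) ℂ :=
  MvPolynomial.bind₁ (shiftFun n v c)

/-- The shift `x_v ↦ x_v + c` on variables. -/
theorem shiftAlg_X {n : ℕ} (v : Idx n) (c : ℂ) (w : Idx n) :
    shiftAlg n v c (MvPolynomial.X w) =
      if w = v then MvPolynomial.X v + MvPolynomial.C c else MvPolynomial.X w :=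
  MvPolynomial.bind₁_X_right _ _

/-- The shift by `−c` undoes the shift by `c`. -/
theorem shiftAlg_leftInverse {n : ℕ} (v : Idx n) (c : ℂ) :
    Function.LeftInverse (shiftAlg n v (-c)) (shiftAlg n v c) := by
  have hcomp : (shiftAlg n v (-c)).comp (shiftAlg n v c) = AlgHom.id ℂ _ := by
    refine MvPolynomial.algHom_ext fun w => ?_
    rw [AlgHom.comp_apply, AlgHom.id_apply, shiftAlg_X]
    split_ifs with h
    · subst h
      rw [map_add, shiftAlg_X, if_pos rfl, MvPolynomial.algHom_C, MvPolynomial.algebraMap_eq,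
        MvPolynomial.C_neg]
      ring
    · rw [shiftAlg_X, if_neg h]
  intro P
  rw [← AlgHom.comp_apply, hcomp, AlgHom.id_apply]

/-- The shift endomorphism of `ℂ[X, b]` is injective. -/
theorem shiftAlg_injective {n : ℕ} (v : Idx n) (c : ℂ) : Function.Injective (shiftAlg n v c) :=
  (shiftAlg_leftInverse v c).injective

/-- The shift `x_v ↦ x_v + 1` composed into `ℂ(X, b)`. -/
def polyShift (n : ℕ) (v : Idx n) : MvPolynomial (Idx n) ℂ →ₐ[ℂ] GF n :=
  (IsScalarTower.toAlgHom ℂ (MvPolynomial (Idx n) ℂ) (GF n)).comp (shiftAlg n v 1)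

/-- The shift followed by `ℂ[X, b] → ℂ(X, b)` is injective. -/
theorem polyShift_injective {n : ℕ} (v : Idx n) : Function.Injective (polyShift n v) :=
  (IsFractionRing.injective (MvPolynomial (Idx n) ℂ) (GF n)).comp (shiftAlg_injective v 1)

/-- **The shift `x_v ↦ x_v + 1` as a `ℂ`-algebra endomorphism of the FIELD `ℂ(X, b)`.** -/
def shift (n : ℕ) (v : Idx n) : GF n →ₐ[ℂ] GF n :=
  IsFractionRing.liftAlgHom (polyShift_injective v)

/-- The field shift restricted to polynomials is the polynomial shift (by `1`). -/
theorem shift_algebraMap {n : ℕ} (v : Idx n) (P : MvPolynomial (Idx n) ℂ) :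
    shift n v (algebraMap (MvPolynomial (Idx n) ℂ) (GF n) P) =
      algebraMap (MvPolynomial (Idx n) ℂ) (GF n) (shiftAlg n v 1 P) := by
  rw [shift, IsFractionRing.liftAlgHom_apply, IsFractionRing.lift_algebraMap]
  rfl

/-- The field shift on variables: `x_v ↦ x_v + 1`, other variables fixed. -/
theorem shift_gE {n : ℕ} (v w : Idx n) :
    shift n v (gE n w) = if w = v then gE n v + 1 else gE n w := by
  show shift n v (algebraMap _ _ (MvPolynomial.X w)) = _
  rw [shift_algebraMap, shiftAlg_X]
  split_ifs
  · rw [map_add, MvPolynomial.C_1, map_one]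
    rfl
  · rfl

/-- The field shift fixes every variable other than `x_v`. -/
theorem shift_gE_of_ne {n : ℕ} {v w : Idx n} (h : w ≠ v) : shift n v (gE n w) = gE n w := by
  rw [shift_gE, if_neg h]

/-- The field shift moves `x_v` to `x_v + 1`. -/
theorem shift_gE_self {n : ℕ} (v : Idx n) : shift n v (gE n v) = gE n v + 1 := by
  rw [shift_gE, if_pos rfl]

end Summit.MatrixMultiplication.MatrixMultiplication.Theorems.LinearSolveSplitSlsExponentFloor

end
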